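import Literature.NumberTheory.EllipticCurves.FormalGroupHasseInvariantProofs
import Literature.RingTheory.FormalGroups.DworkFrobeniusLift
import HarnessLib

/-!
# Uniqueness of the formal chart: a formal point `(ξ, υ)` of `W` with `-ξ/υ = τ` IS `(x(τ), y(τ))`
# (Silverman AEC IV.1.1, poles cleared; proofs only)

Trunk T-NT-EC (Literature/NumberTheory/EllipticCurves). Silverman (AEC IV.1.1) constructs the
expansion `w(z)` of `w = -1/y` in the parameter `z = -x/y` as the UNIQUE fixed point of
`w ↦ f(z, w) = z³ + a₁zw + a₂z²w + a₃w² + a₄zw² + a₆w³`; consequently any pair of functions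
`(ξ, υ)` on the curve (`υ² + a₁ξυ + a₃υ = ξ³ + a₂ξ² + a₄ξ + a₆`) expanded in ANY parameter `t`,
with `z = -ξ/υ = τ(t) ∈ tR⟦t⟧`, is the formal point read through `τ`: `ξ = x(τ(t))`,
`υ = y(τ(t))`. With the poles cleared (`P = τ²ξ`, so `τ³υ = -P`) this is the statement proved
here over an arbitrary commutative ring:

* (tree, `FormalGroupXDerivativeProofs`: `formalXMulSq_sq_eq`, the Weierstrass equation of the
  formal point cleared, `X² = X³ + a₁zX² + a₂z²X² + a₃z³X + a₄z⁴X + a₆z⁶`; here read through `τ`: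
  `formalXMulSq_subst_sq_eq`);
* **`formalXMulSq_subst_eq_of_sq_eq`** — if `τ(0) = 0`, `P(0) = 1` and
  `P² = P³ + a₁τP² + a₂τ²P² + a₃τ³P + a₄τ⁴P + a₆τ⁶`, then `P = X(τ)` (`= formalXMulSq.subst τ`):
  the difference `δ = P - X(τ)` satisfies `δ·(unit) = 0`;
* `formalEta_subst_mul_eq` — then also the invariant differential read through `τ`:
  `η(τ)·(τP^• - 2Pτ^•) = τ^•·((a₁τ - 2)P + a₃τ³)` (`η = dz/ω`; from the tree's
  `η·(zX' - 2X) = (a₁z - 2)X + a₃z³` and the chain rule), i.e. `ω(τ)dτ = dξ/(2υ + a₁ξ + a₃)`.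

Use in the tree: the isogeny `ψ : 𝓔 → 𝓔' = 𝓔/𝒢` of Blakestad–Grant's Prop. 7 is given by rational
functions `x_p = U(x)/φ_ψ(x)²`, `y_p = yM(x)/φ_ψ(x)³` (`VeluKernelReductionProofs`); with
`τ = t_p = -x_p/y_p` (`veluFormalIsog`) and `P = t_p²·x_p`, these lemmas identify `P` with the
`X`-series of `𝓔'` at `t_p` and `ψ^*ω'` with `ω_{𝓔'}(t_p)dt_p` — the hypotheses `X'(T')`,
`ω'(T')dT' = πω` of `PadicSigmaIsogenyCriterionProofs` / `PadicSigmaKohelCriterionProofs`.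

## Sources

* J. H. Silverman, *The Arithmetic of Elliptic Curves*, 2nd ed. (2009), IV.1, Prop. IV.1.1 (a)
  ("the procedure … gives the unique power series `w(z)` … satisfying `w(z) = f(z, w(z))`") and
  the expansions of `x(z)`, `y(z)`, `ω(z)`. [SilvermanAEC2009]
* C. Blakestad, D. Grant, J. Number Theory 249 (2023), Prop. 7 (c) (`t_p = -x_p/y_p`), §2.1
  ("the expansion … in terms of `t` … commute[s] with base change"). [BlakestadGrant2023]

Pure proof file: no definitions, no named facts.
-/

noncomputable section

open PowerSeries

namespace WeierstrassCurve

variable {R : Type*} [CommRing R] (W : WeierstrassCurve R)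

/-- `C r` read through `τ` is `C r`. [folklore] -/
theorem _root_.Literature.NumberTheory.EllipticCurves.C_subst {τ : R⟦X⟧} (r : R) :
    (C r : R⟦X⟧).subst τ = C r := by
  rw [subst_C]; rfl

/-- The same read through any `τ ∈ zR⟦z⟧`. [folklore] -/
theorem formalXMulSq_subst_sq_eq {τ : R⟦X⟧} (hτ : constantCoeff τ = 0) :
    W.formalXMulSq.subst τ ^ 2 = W.formalXMulSq.subst τ ^ 3 + C W.a₁ * τ * W.formalXMulSq.subst τ ^ 2 +
      C W.a₂ * τ ^ 2 * W.formalXMulSq.subst τ ^ 2 + C W.a₃ * τ ^ 3 * W.formalXMulSq.subst τ +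
      C W.a₄ * τ ^ 4 * W.formalXMulSq.subst τ + C W.a₆ * τ ^ 6 := by
  have hs : HasSubst τ := HasSubst.of_constantCoeff_zero' hτ
  have h := congrArg (PowerSeries.subst τ) W.formalXMulSq_sq_eq
  simpa only [subst_add hs, subst_mul hs, subst_pow hs, Literature.NumberTheory.EllipticCurves.C_subst,
    subst_X hs] using h

/-- **Uniqueness of the formal chart.** If `τ ∈ zR⟦z⟧`, `P = 1 + ⋯` and
`P² = P³ + a₁τP² + a₂τ²P² + a₃τ³P + a₄τ⁴P + a₆τ⁶` (the cleared Weierstrass equation of a pair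
`(ξ, υ) = (P/τ², -P/τ³)`, so `τ = -ξ/υ`), then **`P = X(τ)`**: the formal point is the only
solution through the origin in its own parameter. [Silverman AEC IV.1.1 (a) (uniqueness of `w(z)`)]
[cite: SilvermanAEC2009, IV.1.1] -/
theorem formalXMulSq_subst_eq_of_sq_eq {τ P : R⟦X⟧} (hτ : constantCoeff τ = 0) (hP : constantCoeff P = 1)
    (heq : P ^ 2 = P ^ 3 + C W.a₁ * τ * P ^ 2 + C W.a₂ * τ ^ 2 * P ^ 2 + C W.a₃ * τ ^ 3 * P +
      C W.a₄ * τ ^ 4 * P + C W.a₆ * τ ^ 6) :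
    W.formalXMulSq.subst τ = P := by
  have hs : HasSubst τ := HasSubst.of_constantCoeff_zero' hτ
  set P₀ := W.formalXMulSq.subst τ with hP₀
  have h0 := W.formalXMulSq_subst_sq_eq hτ
  rw [← hP₀] at h0
  have hP₀0 : constantCoeff P₀ = 1 := by
    rw [hP₀, Literature.RingTheory.FormalGroups.constantCoeff_subst_of_constantCoeff_eq_zero hτ,
      constantCoeff_formalXMulSq]
  -- `δ·u = 0` with `u(0) = -1`
  set u := (P + P₀) - (P ^ 2 + P * P₀ + P₀ ^ 2) - C W.a₁ * τ * (P + P₀) - C W.a₂ * τ ^ 2 * (P + P₀) -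
    C W.a₃ * τ ^ 3 - C W.a₄ * τ ^ 4 with hu
  have hδ : (P - P₀) * u = 0 := by
    rw [hu]; linear_combination heq - h0
  have hunit : IsUnit u := by
    rw [isUnit_iff_constantCoeff, hu]
    simp only [map_sub, map_add, map_mul, map_pow, hP, hP₀0, hτ, constantCoeff_C, mul_zero, zero_mul,
      sub_zero, zero_pow two_ne_zero, zero_pow (by norm_num : (3 : ℕ) ≠ 0), zero_pow (by norm_num : (4 : ℕ) ≠ 0)]
    norm_num
  have := hunit.mul_left_eq_zero.mp hδ
  exact (sub_eq_zero.mp this).symm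

/-- **The invariant differential read through `τ`.** Under the hypotheses of
`formalXMulSq_subst_eq_of_sq_eq`: `η(τ)·(τ·P^• - 2P·τ^•) = τ^•·((a₁τ - 2)·P + a₃τ³)`
(`η = dz/ω = formalEta`; since `η·(zX' - 2X) = (a₁z - 2)X + a₃z³`, i.e. `ω = dx/(2y + a₁x + a₃)`,
and `(X∘τ)^• = X'(τ)τ^•`). So `ω(τ(t))·dτ = dξ/(2υ + a₁ξ + a₃)` for `(ξ, υ) = (P/τ², -P/τ³)`.
[Silverman AEC IV.1 (expansion of `ω`); Blakestad–Grant 2023, Prop. 7 (c)] [cite: SilvermanAEC2009, IV.1.1] -/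
theorem formalEta_subst_mul_eq {τ P : R⟦X⟧} (hτ : constantCoeff τ = 0) (hP : constantCoeff P = 1)
    (heq : P ^ 2 = P ^ 3 + C W.a₁ * τ * P ^ 2 + C W.a₂ * τ ^ 2 * P ^ 2 + C W.a₃ * τ ^ 3 * P +
      C W.a₄ * τ ^ 4 * P + C W.a₆ * τ ^ 6) :
    W.formalEta.subst τ * (τ * d⁄dX R P - 2 * P * d⁄dX R τ) =
      d⁄dX R τ * ((C W.a₁ * τ - 2) * P + C W.a₃ * τ ^ 3) := by
  have hs : HasSubst τ := HasSubst.of_constantCoeff_zero' hτ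
  have hX := W.formalXMulSq_subst_eq_of_sq_eq hτ hP heq
  -- the tree identity `η·(zX' - 2X) = (a₁z - 2)X + a₃z³`, read through `τ`
  have h := congrArg (PowerSeries.subst τ) W.formalEta_mul_sub_eq_formalYTilde
  rw [formalYTilde_def] at h
  simp only [subst_mul hs, subst_sub hs, subst_add hs, subst_pow hs, subst_X hs,
    Literature.NumberTheory.EllipticCurves.C_subst, hX] at h
  -- chain rule: `(X∘τ)^• = X'(τ)·τ^•`, i.e. `P^• = X'(τ)τ^•`
  have hchain : d⁄dX R P = (d⁄dX R W.formalXMulSq).subst τ * d⁄dX R τ := by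
    rw [← hX, derivative_subst R hs]
  have h2 : (2 : R⟦X⟧).subst τ = 2 := by
    rw [show (2 : R⟦X⟧) = C (2 : R) from (map_ofNat C 2).symm, subst_C]; rfl
  rw [h2] at h
  rw [hchain]
  linear_combination d⁄dX R τ * h

end WeierstrassCurve
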